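import Summits.QuantumFields.YangMills.Theorems.BalabanUVNodesN06Rgdd13AtPinsPUW
import Summits.QuantumFields.YangMills.Theorems.BalabanUVNodesN06StateLayerAtPinsPUWPar
import Summits.QuantumFields.YangMills.Theorems.BalabanUVNodesN06G0QstarTransferLegAtPinsPULaws
import Summits.QuantumFields.YangMills.Theorems.BalabanUVNodesN06RgddLegAtPinsTPar
import Summits.QuantumFields.YangMills.Theorems.BalabanUVNodesN06StateLayerAtPinsPUW
import Summits.QuantumFields.YangMills.Theorems.BalabanUVNodesN06RgddLegAtPinsT
import Summits.QuantumFields.YangMills.Theorems.BalabanUVNodesN06XdYdLegAtPinsPhysPU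
import Summits.QuantumFields.YangMills.Theorems.BalabanUVNodesN06DvLettersLegAtPinsPU
import Summits.QuantumFields.YangMills.Theorems.BalabanUVNodesN06G0QstarTransferLegAtPinsPU
import Summits.QuantumFields.YangMills.Theorems.BalabanUVNodesN06DgDvdLegAtPinsT
import Literature.MathematicalPhysics.QuantumFieldTheory.Balaban1983to89.B9GradLetterTransportedSupSource
import Literature.MathematicalPhysics.QuantumFieldTheory.Balaban1983to89.B9LettersZSchemasMono
import Literature.MathematicalPhysics.QuantumFieldTheory.Balaban1983to89.B9StateAprioriL1

/-!
# CASCADE-K «K3-D» (director-ym №383) — THE SITE-TRANSPORTER-PARAMETRIC RE-PRESS of `N06Rgdd13AtPinsPUW`: `hrgdd13_of_pinsP_geo9Y_par` = the landed `hrgdd13_of_pinsP_geo9Y` VERBATIM with the record's symmetric site transporter `parSymY x.toKIdx` replaced by a PARAMETER `parT : ∀ i, SiteParY _ i` (every `GpY ∕ GpPhysY ∕ TpicoK ∕ T2coK ∕ RcoK …` letter read at `parT x.toKIdx`; proofs verbatim — the callees are transporter-generic or their landed `_par` twins are called); the `Q⋆` class letter `hqsK` DISPLAYED (the `hQsco12`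 pin and the then-idle `hblkZ12` GONE).  At `parT := fun i => parSymY i` these ARE the originals; at the knit transporter they serve the knit certificate's Sect.-D network «KD» (dag-n06-d g25∕g26, HOME `K3D-CENSUS-g25.md`).  Seat `pub-ymgap-dag-n06-d` (g26), 2026-08-30.  The original module text below applies word for word otherwise.
#

# BalabanUVNodes ∕ N06 ([B9], `Dag.B9_main`) — THE `hrgdd13` LETTER OF THEOREMS 3.12–3.13 AT THE PINS, FROM A SECOND STATE LAYER ABOVE δ₁₂,₃

Track A of `YM-PLAN.md` (cell `pub-ymgap`, HUMAN RULING D-0062), node **N06** = [Balaban1985BackgroundPropagators] Thms 3.1–3.15; seat `pub-ymgap-dag-n06-d` (gen 22, s2 «knit N06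
at the ₁₁ record»).  A LEG of the stage-11 certificate (editions ≥ 109), count-neutral.

WHAT.  The displayed letter `hrgdd13` of editions ≤ 108 — `R(U)∘D*_U∘G₁(U)∘∇*_{U,μ} : bHXA x ε → bHXT x U ε′` at `(Br ε ε′, δ₁₂,₃)`, the second-order word of (3.133)∕(3.153) read
from the flat bond input class (3.39) into print's TRANSPORTED site class (3.40) — DERIVED: dag-n06-c's leg `…N06RgddLegAtPinsT.rgdd_of_pinsT` (P-HRGDD (A)–(D), dag-n06-l ∕
dag-n06-c) composes it from a STATE-LAYER TUPLE at rates `(δK, δP)` with `δ₁₂,₃ + 5τR ≤ δK`, `δ₁₂,₃ + 4τR ≤ δP`, i.e. ABOVE the letter's own rate.  The certificate's state layer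
of record (`…N06StateLayerAtPinsPUW.hStateTuplesW_of_pinsP_geo9Y`, U8) sits BELOW δ₁₂,₃ (its level-13 letter inputs are pinned at δ₁₂,₃ and its budget reads `δK + τ + σ ≤ δ₃`,
`δP + σ + 2τ ≤ δ₁₂,₃`), so this file instantiates it a SECOND time: §1 re-derives every level-13 letter input at an INTERMEDIATE rate `δ13` (`δP + σ + 2τ ≤ δ13 < δ₁₂,₀`) from
the G₀ layer and rows 19 by the landed legs — dag-n06-c `dgDvd_pdgDvd_of_pinsT_all` (UNIT D), `dv_letters_of_pins`, `pXDv_of_pins_KX`, this seat's `hXd_of_pinsP_geo9Y`,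
`dgDH_dgDHd_of_pinsP_geo9Y`, `pYDH_of_pinsP_geo9Y`, dag-n06-l `g0qstar_transfer_letters_of_pins` — §2 runs the U8 layer at `(δK, δP)`, §3 feeds its `hst10` tuple, the G₀ layer,
the identities, (3.49) and the ℓ¹ control of `bHK` to `rgdd_of_pinsT`.  ONE theorem ★★★ `hrgdd13_of_pinsP_geo9Y`; every input is a displayed binder or a derived fact of the
certificate of record (ED.107 «VH» p761921), on ONE regime `(M₀, a₀)`; output = the `hrgdd13` binder shape with `∃ MR aR Br` (threshold, sub-regime `aR ≤ a₀`, constant).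

HONEST LABEL: helper (plumbing of landed legs), count-neutral; N06 NOT discharged; nothing continuum ∕ OS ∕ mass gap ∕ Clay.
[cite: Balaban1985BackgroundPropagators, Thm 3.3 (3.42)–(3.47) pp.397–399, (3.49) p.399, (3.35) p.396, (3.39)–(3.40) p.397, Thms 3.12–3.13 (3.130)–(3.133) pp.421–422,
(3.137)–(3.138) p.423, (3.151)–(3.153) p.426; Balaban1984PropagatorsII, (2.51)–(2.56) pp.232–233, Lemma 2.1 (2.60)–(2.61) p.234, (2.137) p.247]
-/

noncomputable section

namespace Summit.QuantumFields.YangMills.BalabanUVNodes.N06Rgdd13AtPinsPUWPar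

open Literature.MathematicalPhysics.QuantumFieldTheory.Balaban1983to89
open Literature.MathematicalPhysics.QuantumFieldTheory.Balaban1983to89.Node00
open Literature.MathematicalPhysics.QuantumFieldTheory.Balaban1983to89.Node00.OpsYSectDCoords (DvcoKH DvscoKH QscoKH RcoK T2coK TpicoK cR39_trBasis_pos)
open Literature.MathematicalPhysics.QuantumFieldTheory.Balaban1983to89.B9Thm39ReadingCoords (basisBound39 cR39 cR39_nonneg coordBound39)
open Literature.MathematicalPhysics.QuantumFieldTheory.Balaban1983to89.B9Thm34Ext (toB6)
open Literature.MathematicalPhysics.QuantumFieldTheory.Balaban1983to89.B11SectG (BlockNorm HasMaj RowSum)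
open Literature.MathematicalPhysics.QuantumFieldTheory.Balaban1983to89.B9Thm312Whole (GeoOK Ops cNorm)
open Literature.MathematicalPhysics.QuantumFieldTheory.Balaban1983to89.B9Thm312WholeClasses (cNormR rwt rwt_nonneg)
open Literature.MathematicalPhysics.QuantumFieldTheory.Balaban1983to89.B9CoReadingCoords (DcoK DscoK GcoK XBK blkBK cdBₗ cdsBₗ coordOpK)
open Literature.MathematicalPhysics.QuantumFieldTheory.Balaban1983to89.B9CoReadingCoordsS (GcoS XSK blkSK sIK)
open Literature.MathematicalPhysics.QuantumFieldTheory.Balaban1983to89.B9CoReadingCoordsH (XHK blkHK)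
open Literature.MathematicalPhysics.QuantumFieldTheory.Balaban1983to89.B9CoReadingCoordsTranspose (TrIdx trBasis)
open Literature.MathematicalPhysics.QuantumFieldTheory.Balaban1983to89.B9PinMembersKLevelV1 (MemberY bg9Y geo9Y geo9Y_M)
open Literature.MathematicalPhysics.QuantumFieldTheory.Balaban1983to89.B9BackgroundsKLevelV1R (MemOfFam RegFamY bg9YR mem_of_reg335R)
open Literature.MathematicalPhysics.QuantumFieldTheory.Balaban1983to89.B9GeoLemma21KLevelV1 (geo9Y_dist_comm geo9Y_dist_triangle geo9Y_len_pos rowSum261_geo9Y)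
open Literature.MathematicalPhysics.QuantumFieldTheory.Balaban1983to89.B9GeoNormsKLevelV1 (geo9K geo9K_dist_nonneg)
open Literature.MathematicalPhysics.QuantumFieldTheory.Balaban1983to89.B7Prop2SpecialUnitary (specialUnitaryUnits specialUnitaryUnits_le_U1 specialUnitaryUnits_le_unitaryUnits)
open Literature.MathematicalPhysics.QuantumFieldTheory.Balaban1983to89.B9PerturbationMajorantAlgebra (CurrentMaj Proj349Maj Thm31GpMaj hasMaj_weaken)
open Literature.MathematicalPhysics.QuantumFieldTheory.Balaban1983to89.B9PerturbationMajorantsAtLetters (BcoKH BdcoKH PcoK rcoK_eq)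
open Literature.MathematicalPhysics.QuantumFieldTheory.Balaban1983to89.B9MultiscaleSmoothPartitionYNear (rNear)
open Literature.MathematicalPhysics.QuantumFieldTheory.Balaban1983to89.B9MultiscaleSmoothPartitionYLip (CLip CLip_nonneg)
open Literature.MathematicalPhysics.QuantumFieldTheory.Balaban1983to89.B9SmoothHolderClassP (bHZKP bHZKPG bHZKP_κ bHZPG)
open Literature.MathematicalPhysics.QuantumFieldTheory.Balaban1983to89.B9GradViaDivLettersTransported (taxiB taxiS)
open Literature.MathematicalPhysics.QuantumFieldTheory.Balaban1983to89.B9PerturbationSplitAtLetters (Ta2LcoK TaLcoK Tb2LcoKH TbLcoKH)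
open Literature.MathematicalPhysics.QuantumFieldTheory.Balaban1983to89.B9PerturbationL2Delta2 (D2coK)
open Literature.MathematicalPhysics.QuantumFieldTheory.Balaban1983to89.B9SmoothHolderClassPProducers (CTel CTel_nonneg)
open Literature.MathematicalPhysics.QuantumFieldTheory.Balaban1983to89.B9RowSum261DefiniteFaces (rowConst261 rowConst261_nonneg)
open Literature.MathematicalPhysics.QuantumFieldTheory.Balaban1983to89.B9SectDSup (weightNorm)
open Literature.MathematicalPhysics.QuantumFieldTheory.Balaban1983to89.B6RandomWalk (HasMajorant)
open Literature.MathematicalPhysics.QuantumFieldTheory.Balaban1983to89.B6RandomWalkHom (HasMajorantHom)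
open Literature.MathematicalPhysics.QuantumFieldTheory.Balaban1983to89.B9Thm312WholeStepRegular (LettersS3131 StepS)
open Literature.MathematicalPhysics.QuantumFieldTheory.Balaban1983to89.B9CoReadingCoordsHolder (PK blkPK probeK w₀K)
open Literature.MathematicalPhysics.QuantumFieldTheory.Balaban1983to89.B9CoReadingCoordsHolderAdm (holderProbesKA wKA)
open Literature.MathematicalPhysics.QuantumFieldTheory.Balaban1983to89.B9RWSums343Holder (HolderProbes)
open Literature.MathematicalPhysics.QuantumFieldTheory.Balaban1983to89.B9Thm313WholeDir (Thm33G0DirR)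
open Literature.MathematicalPhysics.QuantumFieldTheory.Balaban1983to89.B9Thm313WholeDirInputBC (Letters313IML)
open Literature.MathematicalPhysics.QuantumFieldTheory.Balaban1983to89.B9LettersHZAtOne (plateau_pos)
open Literature.MathematicalPhysics.QuantumFieldTheory.Balaban1983to89.B9CoReadingCoordsInput (bHK)
open Literature.MathematicalPhysics.QuantumFieldTheory.Balaban1983to89.B9CoReadingCoordsInputS (bHS)
open Literature.MathematicalPhysics.QuantumFieldTheory.Balaban1983to89.B9CoRealizesRelAtLetters (RelB)
open Literature.MathematicalPhysics.QuantumFieldTheory.Balaban1983to89.B9Thm33G0ProbeZeroAtCutPins (pX0_of_pins)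
open Literature.MathematicalPhysics.QuantumFieldTheory.Balaban1983to89.B6GlobalChartV1 (PV blkV1)
open Literature.MathematicalPhysics.QuantumFieldTheory.Balaban1983to89.B6Ineq2142KLevelV1 (lvl β)
open Literature.MathematicalPhysics.QuantumFieldTheory.Balaban1983to89.B6Geom246MultiLevelTorus (geomT)
open Summit.QuantumFields.YangMills.BalabanUVNodes.N06HolderPinsGradedAtRecord (links_le_one)
open Summit.QuantumFields.YangMills.BalabanUVNodes.N06TbHLegAtPinsPhysPU (htbH_of_pinsP43_geo9Y)
open Summit.QuantumFields.YangMills.BalabanUVNodes.N06LettersSAtPinsPU (hLettersS_of_pinsP44_geo9Y)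
open Summit.QuantumFields.YangMills.BalabanUVNodes.N06StateClassFactsAtPinsPU (hStateFacts_of_pinsP_geo9Y)
open Summit.QuantumFields.YangMills.BalabanUVNodes.N06StateProducerG0AtPinsPU (hG0S2_of_pinsP_geo9Y)
open Summit.QuantumFields.YangMills.BalabanUVNodes.N06StateProducersAAtPinsPU (hProducersA_of_pinsP_geo9Y)
open Summit.QuantumFields.YangMills.BalabanUVNodes.N06StateProducersBAtPinsPUW (hProducersBW_of_pinsP_geo9Y)
open Summit.QuantumFields.YangMills.BalabanUVNodes.N06StatePairsAtPinsPU (hStatePairs_of_pinsP_geo9Y)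
open Summit.QuantumFields.YangMills.BalabanUVNodes.N06StateAssemblyAtPinsPUW (hStateAssemblyW_of_faces)
open Literature.MathematicalPhysics.QuantumFieldTheory.Balaban1983to89.B9SectDL2Decay (BlockBd)
open Literature.MathematicalPhysics.QuantumFieldTheory.Balaban1983to89.B9Thm312WholeDir (Thm33G0Dir Thm33G0L2M)
open Literature.MathematicalPhysics.QuantumFieldTheory.Balaban1983to89.B9RWSums343to347Whole (Facts347)
open Literature.MathematicalPhysics.QuantumFieldTheory.Balaban1983to89.B9RWSums347DefiniteFaces (exp261 facts347_exp261_geo9Y geo9Y_scalars)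
open Literature.MathematicalPhysics.QuantumFieldTheory.Balaban1983to89.B9GradViaDivLettersAtPins (DvcoKH_eq_sum JcoKH rJ)
open Literature.MathematicalPhysics.QuantumFieldTheory.Balaban1983to89.B9Thm313WholeDvAtPinsR (dGDv_pinsB dGDvd_pinsB gD2_pinsB gDv_pinsB pXDv_pinsB)
open Literature.MathematicalPhysics.QuantumFieldTheory.Balaban1983to89.Node00.OpsYNablaBridge (chartY)
open Literature.MathematicalPhysics.QuantumFieldTheory.Balaban1983to89.B9BackgroundsKLevelV1P (bg9KP mem_of_reg335P)
open Literature.MathematicalPhysics.QuantumFieldTheory.Balaban1983to89.B9SmoothHolderClassPI (bHZKPIfam bHZPIfam transfer_threshold_geo9K)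
open Literature.MathematicalPhysics.QuantumFieldTheory.Balaban1983to89.B9SmoothHolderClassTClosure (abs_cf_eq_nKT)
open Literature.MathematicalPhysics.QuantumFieldTheory.Balaban1983to89.B9SectBGpLettersY (norm_le_one_and_inv_of_mem)
open Literature.MathematicalPhysics.QuantumFieldTheory.Balaban1983to89.B9GradLetterTransportedInputClassesPI (hasMaj_dgDv_of_h44m hasMaj_pdgDv_of_h45m jLadder_hyp_of_reg335P)
open Literature.MathematicalPhysics.QuantumFieldTheory.Balaban1983to89.B6KLevelCensusIndexV1 (Adm kGeo)
open T4RelativeLadder (UnitaryLike)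
open Literature.MathematicalPhysics.QuantumFieldTheory.Balaban1983to89.B9RWSums346SecondDiff (DirOps310)
open Literature.MathematicalPhysics.QuantumFieldTheory.Balaban1983to89.B9Thm310Whole (Ops310)
open Literature.MathematicalPhysics.QuantumFieldTheory.Balaban1983to89.B9Thm313WholeDvHolderAtPinsGraded (CJG CJG_nonneg thetaL thetaL_nonneg)
open Literature.MathematicalPhysics.QuantumFieldTheory.Balaban1983to89.B9TaxiTransportLadder (plaqV)
open Literature.MathematicalPhysics.QuantumFieldTheory.Balaban1983to89.B9Thm313WholeDvHolderAtPinsPrint (hJ_print)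
open Literature.MathematicalPhysics.QuantumFieldTheory.Balaban1983to89.B9Thm313WholeDvHolderFromDdsFree (pYDH_of_h45Y_one)
open Literature.MathematicalPhysics.QuantumFieldTheory.Balaban1983to89.B6Prop22KLevelTorusCensusEta (nKT)
open Summit.QuantumFields.YangMills.BalabanUVNodes.N06XdLegAtPinsPhysRU (one_le_CLip)
open Literature.MathematicalPhysics.QuantumFieldTheory.Balaban1983to89.B9Thm313WholeG1PairMembersRegular (g1Pair_members_of_stateS)
open Literature.MathematicalPhysics.QuantumFieldTheory.Balaban1983to89.B9Thm313WholeRDvsWordPrintCurrency (hasMaj_R_dvs_comp_into_bHZPIfam)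
open Literature.MathematicalPhysics.QuantumFieldTheory.Balaban1983to89.B9CoReadingCoordsInputExpMono (hasMaj_bHK_of_le)
open Literature.MathematicalPhysics.QuantumFieldTheory.Balaban1983to89.B9DivViaGradLettersAtPins (DvscoKH_eq_sum JTcoKH)
open Literature.MathematicalPhysics.QuantumFieldTheory.Balaban1983to89.B9DivLetterTransportedAtPins (hasMaj_JTcoKH_bHZKP_bHZP_pinsR hasMaj_JTcoKH_cNormR_neg_one_pinsR)
open Literature.MathematicalPhysics.QuantumFieldTheory.Balaban1983to89.B9PerturbationMajorantsAtLettersPhys (rcoK_GpPhysY)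
open Literature.MathematicalPhysics.QuantumFieldTheory.Balaban1983to89.B9LettersZQstarFieldsAtPinsR (gQs1_pinsB pXQs_pinsB)
open scoped Matrix.Norms.L2Operator
open Literature.MathematicalPhysics.QuantumFieldTheory.Balaban1983to89.B9Thm312Whole (Thm33G0)
open Literature.MathematicalPhysics.QuantumFieldTheory.Balaban1983to89.B9LettersZSchemasMono (kernel_mono)
open Literature.MathematicalPhysics.QuantumFieldTheory.Balaban1983to89.B9StateAprioriL1 (exists_l1_control_bHK)
open Literature.MathematicalPhysics.QuantumFieldTheory.Balaban1983to89.B9GradLetterTransportedSupSource (hasMaj_bHZPIfam_of_supBlocks)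
open Summit.QuantumFields.YangMills.BalabanUVNodes.N06StateLayerAtPinsPUW (hStateTuplesW_of_pinsP_geo9Y)
open Summit.QuantumFields.YangMills.BalabanUVNodes.N06RgddLegAtPinsT (rgdd_of_pinsT)
open Summit.QuantumFields.YangMills.BalabanUVNodes.N06XdYdLegAtPinsPhysPU (hXd_of_pinsP_geo9Y pYDH_of_pinsP_geo9Y)
open Summit.QuantumFields.YangMills.BalabanUVNodes.N06DgLegAtPinsPhysPU (dgDH_dgDHd_of_pinsP_geo9Y)
open Summit.QuantumFields.YangMills.BalabanUVNodes.N06DvLettersLegAtPinsPU (dv_letters_of_pins pXDv_of_pins_KX)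
open Summit.QuantumFields.YangMills.BalabanUVNodes.N06G0QstarTransferLegAtPinsPU (g0qstar_transfer_letters_of_pins)
open Summit.QuantumFields.YangMills.BalabanUVNodes.N06DgDvdLegAtPinsT (dgDvd_pdgDvd_of_pinsT_all)

variable {N : ℕ}

set_option maxHeartbeats 1600000 in -- nine long supplier instantiations at the member-level pins (the certificate's own budget for the same chain)
/-- ★★★ **`hrgdd13` DERIVED** (module docstring): from the certificate's displayed T-side letters `h31 h49 h43 h44G hD2 hta hBJ`, the G₀ layer (`hG0 hG0D hG0DR hG0L2M he1 hI`,
Theorem 3.3 for G₀ at the flat and `hG0CT` at the transported bond class), print's plaquette budget `hF`, rows 19's G₀-twins `h45X h44m h45Y`, the pins and the five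
input classes of record, and a RATE BUDGET placing a second U8 state layer at `(δK, δP)` above `δ12₃` with its level-13 slots at `δ13 < δ12₀`:
`∃ MR aR Br`, `M₀ ≤ MR`, `0 < aR ≤ a₀`, `0 ≤ Br` on the guards, and for `MR ≤ M`, `Mα₀ ≤ aR`, U ∈ (3.35)–(3.36), every `μ ε ε′` with `0 < ε′ < 1`, `ε′ < ε ≤ ε′ + 1`:
`HasMaj (bHXA x ε) (bHXT x U ε′) (R(U)∘D*_U∘G₁(U)∘∇*_{U,μ}) (Br ε ε′·e^{−δ12₃ d})`.
[cite: Balaban1985BackgroundPropagators, Thms 3.12–3.13 (3.130)–(3.133) pp.421–422, (3.153) p.426, Thm 3.3 (3.44)–(3.47) pp.398–399, (3.49) p.399, (3.39)–(3.40) p.397;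
Balaban1984PropagatorsII, (2.51)–(2.56) pp.232–233, Lemma 2.1 (2.60)–(2.61) p.234] -/
theorem hrgdd13_of_pinsP_geo9Y_par [NeZero N] (θ : Stage3Params) (Mstar : ℕ)
    (parT : ∀ i : B6KLevelCensusIndexV1.KIdx θ.d₆ θ.ℓ₆ θ.hd' θ.hL' θ.b₀ θ.b₁, Node00.SiteParY (Matrix (Fin N) (Fin N) ℂ) i) [∀ x : MemberY θ.d₆ θ.ℓ₆ θ.hd' θ.hL' θ.b₀ θ.b₁ Mstar, Fintype (geo9Y x).Site] [∀ x : MemberY θ.d₆ θ.ℓ₆ θ.hd' θ.hL' θ.b₀ θ.b₁ Mstar, DecidableRel (RelB x.toKIdx)]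
    {R₁ R₂ : RegFamY θ.d₆ θ.ℓ₆ θ.hd' θ.hL' θ.b₀ θ.b₁ Mstar (Matrix (Fin N) (Fin N) ℂ)} (H : MemberY θ.d₆ θ.ℓ₆ θ.hd' θ.hL' θ.b₀ θ.b₁ Mstar → Prop)
    (bI : ∀ x : MemberY θ.d₆ θ.ℓ₆ θ.hd' θ.hL' θ.b₀ θ.b₁ Mstar, FBondY x.toKIdx → IBondY x.toKIdx)
    (hlev : ∀ (x : MemberY θ.d₆ θ.ℓ₆ θ.hd' θ.hL' θ.b₀ θ.b₁ Mstar) (f : FBondY x.toKIdx), lvl x.hN x.D x.hk (bI x f) = (blkV1 x.hN x.D f).1.1)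
    (hβ1 : ∀ (x : MemberY θ.d₆ θ.ℓ₆ θ.hd' θ.hL' θ.b₀ θ.b₁ Mstar) (f : FBondY x.toKIdx), (geomT x.D).dist (β x.hN x.D x.hk (bI x f)) (blkV1 x.hN x.D f) ≤ 1)
    (hbI0 : ∀ (x : MemberY θ.d₆ θ.ℓ₆ θ.hd' θ.hL' θ.b₀ θ.b₁ Mstar) (f : FBondY x.toKIdx), bI x f = bI x ⟨f.src, 0⟩) (hGR : MemOfFam (specialUnitaryUnits (Fin N)) R₁) (c : ℝ)
    -- print's class (3.35) at the letters (the certificate's `hRP1 … .2.1`, `c35Y_le_ten`)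
    {c10 : ℝ} (hc10 : c10 ≤ 10)
    (hP : ∀ (x : MemberY θ.d₆ θ.ℓ₆ θ.hd' θ.hL' θ.b₀ θ.b₁ Mstar) (α₀ : ℝ) (U : (bg9YR (Matrix (Fin N) (Fin N) ℂ) (specialUnitaryUnits (Fin N)) R₁ R₂ x).Cfg),
      (bg9YR (Matrix (Fin N) (Fin N) ℂ) (specialUnitaryUnits (Fin N)) R₁ R₂ x).Reg335 c α₀ U → (bg9KP (Matrix (Fin N) (Fin N) ℂ) (specialUnitaryUnits (Fin N)) x.toKIdx).Reg335 c10 α₀ U)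
    -- ONE input regime for every letter below; the two margins σ τ of the U8 layer; the weights and the five input classes of record
    {M₀ a₀ : ℝ} (hM₀ : 0 ≤ M₀) (ha₀ : 0 < a₀) {σ τ : ℝ} (hσ : 0 < σ) (hτ : 0 < τ)
    (w13 : ℝ → ℝ) (hw13₀ : ∀ s, 0 ≤ w13 s) (hw13₁ : ∀ s, w13 s ≤ 1) (wX : ℝ → ℝ) (hwX₀ : ∀ s, 0 ≤ wX s) (hwX₁ : ∀ s, wX s ≤ 1)
    {s44 : ℝ} (hs440 : 0 < s44) (hs441 : s44 < 1) (hw1344 : 0 < w13 s44) (hwX44 : 0 < wX s44) (sch : ℝ → ℝ) (hsch0 : ∀ β', 0 ≤ β' → β' < 1 → 0 < sch β') (hsch1 : ∀ β', 0 ≤ β' → β' < 1 → sch β' < 1)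
    (hwsch : ∀ β', 0 ≤ β' → β' < 1 → 0 < w13 (sch β'))
    (bH13 : ∀ x : MemberY θ.d₆ θ.ℓ₆ θ.hd' θ.hL' θ.b₀ θ.b₁ Mstar, (bg9YR (Matrix (Fin N) (Fin N) ℂ) (specialUnitaryUnits (Fin N)) R₁ R₂ x).Cfg → BlockNorm (toB6 (geo9Y x) 1 (H x)) (XSK (TrIdx N) x.toKIdx → ℝ))
    (hbH13 : ∀ (x : MemberY θ.d₆ θ.ℓ₆ θ.hd' θ.hL' θ.b₀ θ.b₁ Mstar) (U : (bg9YR (Matrix (Fin N) (Fin N) ℂ) (specialUnitaryUnits (Fin N)) R₁ R₂ x).Cfg), bH13 x U =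
      letI : Fintype (geo9K x.toKIdx).Site := (inferInstance : Fintype (geo9Y x).Site);
      bHZPG (κ := TrIdx N) x.toKIdx (trBasis N) (taxiS x.toKIdx (bg9YR (Matrix (Fin N) (Fin N) ℂ) (specialUnitaryUnits (Fin N)) R₁ R₂ x) (fun U => U) U) (R := (1 : ℝ)) (H := H x) w13 hw13₀ hw13₁)
    (hκ13 : ∀ (x : MemberY θ.d₆ θ.ℓ₆ θ.hd' θ.hL' θ.b₀ θ.b₁ Mstar) (U : (bg9YR (Matrix (Fin N) (Fin N) ℂ) (specialUnitaryUnits (Fin N)) R₁ R₂ x).Cfg), (bH13 x U).κ ≤ 1 + CLip θ.d₆ θ.ℓ₆)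
    (bXH : ∀ x : MemberY θ.d₆ θ.ℓ₆ θ.hd' θ.hL' θ.b₀ θ.b₁ Mstar, (bg9YR (Matrix (Fin N) (Fin N) ℂ) (specialUnitaryUnits (Fin N)) R₁ R₂ x).Cfg → BlockNorm (toB6 (geo9Y x) 1 (H x)) (XBK (TrIdx N) x.toKIdx → ℝ))
    (hbXH : ∀ (x : MemberY θ.d₆ θ.ℓ₆ θ.hd' θ.hL' θ.b₀ θ.b₁ Mstar) (U : (bg9YR (Matrix (Fin N) (Fin N) ℂ) (specialUnitaryUnits (Fin N)) R₁ R₂ x).Cfg), bXH x U =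
      letI : Fintype (geo9K x.toKIdx).Site := (inferInstance : Fintype (geo9Y x).Site);
      bHZKPG (κ := TrIdx N) x.toKIdx (trBasis N) (taxiB x.toKIdx (bg9YR (Matrix (Fin N) (Fin N) ℂ) (specialUnitaryUnits (Fin N)) R₁ R₂ x) (fun U => U) U) (R := (1 : ℝ)) (H := H x) wX hwX₀ hwX₁)
    (bHXA : ∀ x : MemberY θ.d₆ θ.ℓ₆ θ.hd' θ.hL' θ.b₀ θ.b₁ Mstar, ℝ → BlockNorm (toB6 (geo9Y x) 1 (H x)) (XBK (TrIdx N) x.toKIdx → ℝ))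
    (hbHXA : ∀ x : MemberY θ.d₆ θ.ℓ₆ θ.hd' θ.hL' θ.b₀ θ.b₁ Mstar, bHXA x = fun ε => letI : Fintype (geo9K x.toKIdx).Site := (inferInstance : Fintype (geo9Y x).Site); bHK x.toKIdx (bI x) ε)
    (bHXT : ∀ x : MemberY θ.d₆ θ.ℓ₆ θ.hd' θ.hL' θ.b₀ θ.b₁ Mstar, (bg9YR (Matrix (Fin N) (Fin N) ℂ) (specialUnitaryUnits (Fin N)) R₁ R₂ x).Cfg → ℝ →
      BlockNorm (toB6 (geo9Y x) 1 (H x)) (XSK (TrIdx N) x.toKIdx → ℝ))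
    (hbHXT : ∀ (x : MemberY θ.d₆ θ.ℓ₆ θ.hd' θ.hL' θ.b₀ θ.b₁ Mstar) (U : (bg9YR (Matrix (Fin N) (Fin N) ℂ) (specialUnitaryUnits (Fin N)) R₁ R₂ x).Cfg), bHXT x U = fun ε =>
      letI : Fintype (geo9K x.toKIdx).Site := (inferInstance : Fintype (geo9Y x).Site)
      bHZPIfam (κ := TrIdx N) x.toKIdx (trBasis N) (taxiS x.toKIdx (bg9YR (Matrix (Fin N) (Fin N) ℂ) (specialUnitaryUnits (Fin N)) R₁ R₂ x) (fun U => U) U) (R := (1 : ℝ)) (H := H x) ε)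
    (bHXTA : ∀ x : MemberY θ.d₆ θ.ℓ₆ θ.hd' θ.hL' θ.b₀ θ.b₁ Mstar, (bg9YR (Matrix (Fin N) (Fin N) ℂ) (specialUnitaryUnits (Fin N)) R₁ R₂ x).Cfg → ℝ →
      BlockNorm (toB6 (geo9Y x) 1 (H x)) (XBK (TrIdx N) x.toKIdx → ℝ))
    (hbHXTA : ∀ (x : MemberY θ.d₆ θ.ℓ₆ θ.hd' θ.hL' θ.b₀ θ.b₁ Mstar) (U : (bg9YR (Matrix (Fin N) (Fin N) ℂ) (specialUnitaryUnits (Fin N)) R₁ R₂ x).Cfg), bHXTA x U = fun ε =>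
      letI : Fintype (geo9K x.toKIdx).Site := (inferInstance : Fintype (geo9Y x).Site)
      bHZKPIfam (κ := TrIdx N) x.toKIdx (trBasis N) (taxiB x.toKIdx (bg9YR (Matrix (Fin N) (Fin N) ℂ) (specialUnitaryUnits (Fin N)) R₁ R₂ x) (fun U => U) U) (R := (1 : ℝ)) (H := H x) ε)
    -- the operator record of Theorems 3.12–3.13 and its pins; the Hölder probes; Theorem 3.10's record (rows 19) and its direction operators
    (𝔬12 : ∀ x : MemberY θ.d₆ θ.ℓ₆ θ.hd' θ.hL' θ.b₀ θ.b₁ Mstar, B9Thm312Whole.Ops (geo9Y x) (bg9YR (Matrix (Fin N) (Fin N) ℂ) (specialUnitaryUnits (Fin N)) R₁ R₂ x) (XBK (TrIdx N) x.toKIdx) (XBK (TrIdx N) x.toKIdx) (XHK (TrIdx N) x.toKIdx) (XSK (TrIdx N) x.toKIdx))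
    (hblk12 : ∀ x : MemberY θ.d₆ θ.ℓ₆ θ.hd' θ.hL' θ.b₀ θ.b₁ Mstar, (𝔬12 x).blk = blkBK x.toKIdx (bI x)) (hblkW12 : ∀ x : MemberY θ.d₆ θ.ℓ₆ θ.hd' θ.hL' θ.b₀ θ.b₁ Mstar, (𝔬12 x).blkW = blkSK x.toKIdx (sIK x.toKIdx (bI x)))
    (hblkY12 : ∀ x : MemberY θ.d₆ θ.ℓ₆ θ.hd' θ.hL' θ.b₀ θ.b₁ Mstar, (𝔬12 x).blkY = blkBK x.toKIdx (bI x))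
    (O : ∀ x : MemberY θ.d₆ θ.ℓ₆ θ.hd' θ.hL' θ.b₀ θ.b₁ Mstar, BondOpY (Matrix (Fin N) (Fin N) ℂ) x.toKIdx)
    (hG0co12 : ∀ (x : MemberY θ.d₆ θ.ℓ₆ θ.hd' θ.hL' θ.b₀ θ.b₁ Mstar) (U : (bg9YR (Matrix (Fin N) (Fin N) ℂ) (specialUnitaryUnits (Fin N)) R₁ R₂ x).Cfg), (𝔬12 x).G0 U = GcoK x.toKIdx (trBasis N) (bg9YR (Matrix (Fin N) (Fin N) ℂ) (specialUnitaryUnits (Fin N)) R₁ R₂ x) (fun U => U) (O x) U)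
    (hDco12 : ∀ (x : MemberY θ.d₆ θ.ℓ₆ θ.hd' θ.hL' θ.b₀ θ.b₁ Mstar) (U : (bg9YR (Matrix (Fin N) (Fin N) ℂ) (specialUnitaryUnits (Fin N)) R₁ R₂ x).Cfg), (𝔬12 x).D U = DcoK x.toKIdx (trBasis N) (bg9YR (Matrix (Fin N) (Fin N) ℂ) (specialUnitaryUnits (Fin N)) R₁ R₂ x) (fun U => U) U)
    (hDsco12 : ∀ (x : MemberY θ.d₆ θ.ℓ₆ θ.hd' θ.hL' θ.b₀ θ.b₁ Mstar) (U : (bg9YR (Matrix (Fin N) (Fin N) ℂ) (specialUnitaryUnits (Fin N)) R₁ R₂ x).Cfg), (𝔬12 x).Dstar U = DscoK x.toKIdx (trBasis N) (bg9YR (Matrix (Fin N) (Fin N) ℂ) (specialUnitaryUnits (Fin N)) R₁ R₂ x) (fun U => U) U)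
    (Δ2 : ∀ x : MemberY θ.d₆ θ.ℓ₆ θ.hd' θ.hL' θ.b₀ θ.b₁ Mstar, BondOpY (Matrix (Fin N) (Fin N) ℂ) x.toKIdx)
    (hTpico12 : ∀ (x : MemberY θ.d₆ θ.ℓ₆ θ.hd' θ.hL' θ.b₀ θ.b₁ Mstar) (U : (bg9YR (Matrix (Fin N) (Fin N) ℂ) (specialUnitaryUnits (Fin N)) R₁ R₂ x).Cfg), (𝔬12 x).Tpi U = TpicoK x.toKIdx (trBasis N) (bg9YR (Matrix (Fin N) (Fin N) ℂ) (specialUnitaryUnits (Fin N)) R₁ R₂ x) (fun U => U) (parT x.toKIdx) (GpPhysY x.toKIdx (parT x.toKIdx)) U)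
    (hT2co12 : ∀ (x : MemberY θ.d₆ θ.ℓ₆ θ.hd' θ.hL' θ.b₀ θ.b₁ Mstar) (U : (bg9YR (Matrix (Fin N) (Fin N) ℂ) (specialUnitaryUnits (Fin N)) R₁ R₂ x).Cfg) , (𝔬12 x).T2 U = T2coK x.toKIdx (trBasis N) (bg9YR (Matrix (Fin N) (Fin N) ℂ) (specialUnitaryUnits (Fin N)) R₁ R₂ x) (fun U => U) (parT x.toKIdx) (GpPhysY x.toKIdx (parT x.toKIdx)) (Δ2 x) U)
    (hDvco12 : ∀ (x : MemberY θ.d₆ θ.ℓ₆ θ.hd' θ.hL' θ.b₀ θ.b₁ Mstar) (U : (bg9YR (Matrix (Fin N) (Fin N) ℂ) (specialUnitaryUnits (Fin N)) R₁ R₂ x).Cfg), (𝔬12 x).Dv U = DvcoKH x.toKIdx (trBasis N) (bg9YR (Matrix (Fin N) (Fin N) ℂ) (specialUnitaryUnits (Fin N)) R₁ R₂ x) (fun U => U) U)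
    (hDvsco12 : ∀ (x : MemberY θ.d₆ θ.ℓ₆ θ.hd' θ.hL' θ.b₀ θ.b₁ Mstar) (U : (bg9YR (Matrix (Fin N) (Fin N) ℂ) (specialUnitaryUnits (Fin N)) R₁ R₂ x).Cfg), (𝔬12 x).Dvstar U = DvscoKH x.toKIdx (trBasis N) (bg9YR (Matrix (Fin N) (Fin N) ℂ) (specialUnitaryUnits (Fin N)) R₁ R₂ x) (fun U => U) U)
    (hRco12 : ∀ (x : MemberY θ.d₆ θ.ℓ₆ θ.hd' θ.hL' θ.b₀ θ.b₁ Mstar) (U : (bg9YR (Matrix (Fin N) (Fin N) ℂ) (specialUnitaryUnits (Fin N)) R₁ R₂ x).Cfg),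
      (𝔬12 x).R U = RcoK x.toKIdx (trBasis N) (bg9YR (Matrix (Fin N) (Fin N) ℂ) (specialUnitaryUnits (Fin N)) R₁ R₂ x) (fun U => U) (parT x.toKIdx) (GpPhysY x.toKIdx (parT x.toKIdx)) U)
    (𝔭A : ∀ x : MemberY θ.d₆ θ.ℓ₆ θ.hd' θ.hL' θ.b₀ θ.b₁ Mstar, HolderProbes (geo9Y x) (bg9YR (Matrix (Fin N) (Fin N) ℂ) (specialUnitaryUnits (Fin N)) R₁ R₂ x) (XBK (TrIdx N) x.toKIdx) (XBK (TrIdx N) x.toKIdx) (PK (FBondY x.toKIdx) (Fin (θ.d₆ + 1)) (TrIdx N)) (PK (FBondY x.toKIdx) (Fin (θ.d₆ + 1)) (TrIdx N)))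
    {parB : ∀ x : MemberY θ.d₆ θ.ℓ₆ θ.hd' θ.hL' θ.b₀ θ.b₁ Mstar, BondParY (Matrix (Fin N) (Fin N) ℂ) x.toKIdx} (hparB : ∀ x : MemberY θ.d₆ θ.ℓ₆ θ.hd' θ.hL' θ.b₀ θ.b₁ Mstar, parB x = parBY x.toKIdx)
    (h𝔭A : ∀ x : MemberY θ.d₆ θ.ℓ₆ θ.hd' θ.hL' θ.b₀ θ.b₁ Mstar, 𝔭A x = holderProbesKA x.toKIdx (trBasis N) (bg9YR (Matrix (Fin N) (Fin N) ℂ) (specialUnitaryUnits (Fin N)) R₁ R₂ x) (fun U => U) (parB x) (bI x))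
    {ιA AA : MemberY θ.d₆ θ.ℓ₆ θ.hd' θ.hL' θ.b₀ θ.b₁ Mstar → Type}
    (𝔬A : ∀ x : MemberY θ.d₆ θ.ℓ₆ θ.hd' θ.hL' θ.b₀ θ.b₁ Mstar, Ops310 (geo9Y x) (bg9YR (Matrix (Fin N) (Fin N) ℂ) (specialUnitaryUnits (Fin N)) R₁ R₂ x) (XBK (TrIdx N) x.toKIdx) (XBK (TrIdx N) x.toKIdx) (ιA x) (AA x))
    (𝔡A : ∀ x : MemberY θ.d₆ θ.ℓ₆ θ.hd' θ.hL' θ.b₀ θ.b₁ Mstar, DirOps310 (𝔬A x) (Fin (θ.d₆ + 1)))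
    (h𝔡Ad : ∀ (x : MemberY θ.d₆ θ.ℓ₆ θ.hd' θ.hL' θ.b₀ θ.b₁ Mstar) (U : (bg9YR (Matrix (Fin N) (Fin N) ℂ) (specialUnitaryUnits (Fin N)) R₁ R₂ x).Cfg), (𝔡A x).Dd U = fun μ => coordOpK (trBasis N) (fun _ : Fin (θ.d₆ + 1) => cdBₗ x.toKIdx U μ))
    (h𝔡As : ∀ (x : MemberY θ.d₆ θ.ℓ₆ θ.hd' θ.hL' θ.b₀ θ.b₁ Mstar) (U : (bg9YR (Matrix (Fin N) (Fin N) ℂ) (specialUnitaryUnits (Fin N)) R₁ R₂ x).Cfg), (𝔡A x).Dsd U = fun μ => coordOpK (trBasis N) (fun _ : Fin (θ.d₆ + 1) => cdsBₗ x.toKIdx U μ))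
    -- NUMERICS (implicit, read off the facts): the T-side letters' constants ∕ rates, the G₀ layer's, print's (3.32)-budget `ϑF`, rows 19's `Bi44 BZ BiY` at `δ44 δ45 δ45Y`,
    -- the LEG margin `τR`, the second state layer's rates `δK δP` and the intermediate level-13 rate `δ13`
    {B₀ δ₀ CP δ49 tJ δB B43 δ43 tA δT θ₂ δ₂ B44 δ44G B12₀ B12₂ δ12₀ BHG δ12₃ δ13 δK δP τR ϑF Bi44 δ44 δ45 δ45Y B0T : ℝ} {Bh12 Bi12 BZ BiY BhT BiT : ℝ → ℝ} {Bi2₁₂ Bi2T : ℝ → ℝ → ℝ}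
    (hB₀ : 0 ≤ B₀) (hCP : 0 ≤ CP) (htJ : 0 ≤ tJ) (hB43 : 0 ≤ B43) (htA : 0 ≤ tA) (hθ₂ : 0 ≤ θ₂) (hB44 : 0 ≤ B44) (hB12₀ : 0 ≤ B12₀) (hB12₂ : 0 ≤ B12₂) (hBh12 : ∀ β', 0 ≤ β' → β' < 1 → 0 ≤ Bh12 β')
    (hBi12 : ∀ ε, 0 < ε → ε ≤ 1 → 0 ≤ Bi12 ε) (hBi2₁₂ : ∀ ε β', 0 < ε → ε ≤ 1 → 0 ≤ β' → β' < 1 → 0 ≤ Bi2₁₂ ε β') (hBHG : 0 ≤ BHG) (hwBhG : ∀ s, 0 < s → s < 1 → wX s * Bh12 s ≤ BHG)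
    (hϑF : 0 ≤ ϑF) (hBi44 : 0 ≤ Bi44) (hBZ : ∀ β', 0 ≤ β' → β' < 1 → 0 ≤ BZ β') (hBiY : ∀ β', 0 ≤ β' → β' < 1 → 0 ≤ BiY β')
    (hBiT : ∀ ε, 0 < ε → ε ≤ 1 → 0 ≤ BiT ε) (hBi2T : ∀ ε β', 0 < ε → ε ≤ 1 → 0 ≤ β' → β' < 1 → 0 ≤ Bi2T ε β')
    -- RATE BUDGET: the LEG's margins (`rgdd_of_pinsT`: `δ12₃ + 3τR ≤ δ12₀ ∕ δ49`, `+ 4τR ≤ δP`, `+ 5τR ≤ δK`), the U8 budget of `hStateTuplesW_of_pinsP_geo9Y` at (δK, δP) with the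
    -- level-13 slots read at δ13, and the [4] (2.60) transfer gaps of the level-13 suppliers (`δ13 < δ12₀ ∕ δ44 ∕ δ45 ∕ δ45Y`)
    (hδ30 : 0 ≤ δ12₃) (hτR : 0 < τR) (h3₀ : δ12₃ + 3 * τR ≤ δ12₀) (h3P : δ12₃ + 4 * τR ≤ δP) (h3K : δ12₃ + 5 * τR ≤ δK) (h349 : δ12₃ + 3 * τR ≤ δ49)
    (hr0 : δK + 3 * σ + 4 * τ ≤ δ₀) (hr49 : δK + 3 * σ + 4 * τ ≤ δ49) (hr2 : δK + 3 * σ + 4 * τ ≤ δ₂) (hr44 : δK + 3 * σ + 5 * τ ≤ δ44G) (hrB : δK + 3 * σ + 4 * τ ≤ δB)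
    (hr43 : δK + 2 * σ + τ ≤ δ43) (hrT : δK + τ + σ ≤ δT) (hK3d : δK + τ + σ ≤ δ13) (hKP : δK + τ + σ ≤ δP) (hP0 : δP + 2 * τ ≤ δ12₀) (hP3 : δP + σ + 2 * τ ≤ δ13)
    (h130 : δ13 < δ12₀) (h1344 : δ13 < δ44) (h1345 : δ13 < δ45) (h1345Y : δ13 < δ45Y)
    -- LETTERS (all on the regime (M₀, a₀)): the T-side letters of the U8 layer VERBATIM (`h31 h49 h43 h44G hD2 hta hBJ`)
    (h31 : ∀ x : MemberY θ.d₆ θ.ℓ₆ θ.hd' θ.hL' θ.b₀ θ.b₁ Mstar, M₀ ≤ (geo9Y x).M → ∀ α₀ : ℝ, 0 < α₀ → (geo9Y x).M * α₀ ≤ a₀ → ∀ U : (bg9YR (Matrix (Fin N) (Fin N) ℂ) (specialUnitaryUnits (Fin N)) R₁ R₂ x).Cfg, (bg9YR (Matrix (Fin N) (Fin N) ℂ) (specialUnitaryUnits (Fin N)) R₁ R₂ x).Reg335 c α₀ U →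
      Thm31GpMaj (g := geo9Y x) (blkSK x.toKIdx (sIK x.toKIdx (bI x))) (blkBK x.toKIdx (bI x))
        (GcoS x.toKIdx (trBasis N) (bg9YR (Matrix (Fin N) (Fin N) ℂ) (specialUnitaryUnits (Fin N)) R₁ R₂ x) (fun U => U) (GpY x.toKIdx (parT x.toKIdx)) U)
        (DvcoKH x.toKIdx (trBasis N) (bg9YR (Matrix (Fin N) (Fin N) ℂ) (specialUnitaryUnits (Fin N)) R₁ R₂ x) (fun U => U) U) (DvscoKH x.toKIdx (trBasis N) (bg9YR (Matrix (Fin N) (Fin N) ℂ) (specialUnitaryUnits (Fin N)) R₁ R₂ x) (fun U => U) U) 1 (H x) B₀ δ₀)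
    (h49 : ∀ x : MemberY θ.d₆ θ.ℓ₆ θ.hd' θ.hL' θ.b₀ θ.b₁ Mstar, M₀ ≤ (geo9Y x).M → ∀ α₀ : ℝ, 0 < α₀ → (geo9Y x).M * α₀ ≤ a₀ → ∀ U : (bg9YR (Matrix (Fin N) (Fin N) ℂ) (specialUnitaryUnits (Fin N)) R₁ R₂ x).Cfg, (bg9YR (Matrix (Fin N) (Fin N) ℂ) (specialUnitaryUnits (Fin N)) R₁ R₂ x).Reg335 c α₀ U →
      Proj349Maj (g := geo9Y x) (blkSK x.toKIdx (sIK x.toKIdx (bI x))) (blkBK x.toKIdx (bI x))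
        (PcoK x.toKIdx (trBasis N) (bg9YR (Matrix (Fin N) (Fin N) ℂ) (specialUnitaryUnits (Fin N)) R₁ R₂ x) (fun U => U) (parT x.toKIdx) (GpY x.toKIdx (parT x.toKIdx)) U)
        (DvcoKH x.toKIdx (trBasis N) (bg9YR (Matrix (Fin N) (Fin N) ℂ) (specialUnitaryUnits (Fin N)) R₁ R₂ x) (fun U => U) U) (DvscoKH x.toKIdx (trBasis N) (bg9YR (Matrix (Fin N) (Fin N) ℂ) (specialUnitaryUnits (Fin N)) R₁ R₂ x) (fun U => U) U) 1 (H x) CP δ49)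
    (h43 : ∀ x : MemberY θ.d₆ θ.ℓ₆ θ.hd' θ.hL' θ.b₀ θ.b₁ Mstar, letI : Fintype (geo9K x.toKIdx).Site := (inferInstance : Fintype (geo9Y x).Site); M₀ ≤ (geo9Y x).M → ∀ α₀ : ℝ, 0 < α₀ → (geo9Y x).M * α₀ ≤ a₀ → ∀ U : (bg9YR (Matrix (Fin N) (Fin N) ℂ) (specialUnitaryUnits (Fin N)) R₁ R₂ x).Cfg, (bg9YR (Matrix (Fin N) (Fin N) ℂ) (specialUnitaryUnits (Fin N)) R₁ R₂ x).Reg335 c α₀ U →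
      (bg9YR (Matrix (Fin N) (Fin N) ℂ) (specialUnitaryUnits (Fin N)) R₁ R₂ x).Reg336 c α₀ U →
        HasMaj (cNorm 1 (H x) (𝔬12 x).blk (fun y => (geo9Y_len_pos x y).le) 0) (bH13 x U)
          (GcoS x.toKIdx (trBasis N) (bg9YR (Matrix (Fin N) (Fin N) ℂ) (specialUnitaryUnits (Fin N)) R₁ R₂ x) (fun U => U) (GpY x.toKIdx (parT x.toKIdx)) U ∘ₗ DvscoKH x.toKIdx (trBasis N) (bg9YR (Matrix (Fin N) (Fin N) ℂ) (specialUnitaryUnits (Fin N)) R₁ R₂ x) (fun U => U) U)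
          (fun a a' => B43 * Real.exp (-(δ43 * (geo9Y x).dist a a'))))
    (h44G : ∀ x : MemberY θ.d₆ θ.ℓ₆ θ.hd' θ.hL' θ.b₀ θ.b₁ Mstar, letI : Fintype (geo9K x.toKIdx).Site := (inferInstance : Fintype (geo9Y x).Site); M₀ ≤ (geo9Y x).M → ∀ α₀ : ℝ, 0 < α₀ → (geo9Y x).M * α₀ ≤ a₀ → ∀ U : (bg9YR (Matrix (Fin N) (Fin N) ℂ) (specialUnitaryUnits (Fin N)) R₁ R₂ x).Cfg, (bg9YR (Matrix (Fin N) (Fin N) ℂ) (specialUnitaryUnits (Fin N)) R₁ R₂ x).Reg335 c α₀ U → (bg9YR (Matrix (Fin N) (Fin N) ℂ) (specialUnitaryUnits (Fin N)) R₁ R₂ x).Reg336 c α₀ U →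
      HasMaj (bHZKP (κ := TrIdx N) x.toKIdx (trBasis N) (taxiB x.toKIdx (bg9YR (Matrix (Fin N) (Fin N) ℂ) (specialUnitaryUnits (Fin N)) R₁ R₂ x) (fun U => U) U) (R := (1 : ℝ)) (H := H x) hs440.le hs441.le) (cNorm 1 (H x) (𝔬12 x).blk (fun y => (geo9Y_len_pos x y).le) 1)
        ((𝔬12 x).Dv U ∘ₗ GcoS x.toKIdx (trBasis N) (bg9YR (Matrix (Fin N) (Fin N) ℂ) (specialUnitaryUnits (Fin N)) R₁ R₂ x) (fun U => U) (GpY x.toKIdx (parT x.toKIdx)) U ∘ₗ (𝔬12 x).Dvstar U) (fun a b => B44 * Real.exp (-(δ44G * (geo9Y x).dist a b))))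
    (hD2 : ∀ x : MemberY θ.d₆ θ.ℓ₆ θ.hd' θ.hL' θ.b₀ θ.b₁ Mstar, M₀ ≤ (geo9Y x).M → ∀ α₀ : ℝ, 0 < α₀ → (geo9Y x).M * α₀ ≤ a₀ → ∀ U : (bg9YR (Matrix (Fin N) (Fin N) ℂ) (specialUnitaryUnits (Fin N)) R₁ R₂ x).Cfg, (bg9YR (Matrix (Fin N) (Fin N) ℂ) (specialUnitaryUnits (Fin N)) R₁ R₂ x).Reg335 c α₀ U →
      (bg9YR (Matrix (Fin N) (Fin N) ℂ) (specialUnitaryUnits (Fin N)) R₁ R₂ x).Reg336 c α₀ U → HasMajorant (g := toB6 (geo9Y x) 1 (H x)) (𝔬12 x).blk (D2coK x.toKIdx (trBasis N) (bg9YR (Matrix (Fin N) (Fin N) ℂ) (specialUnitaryUnits (Fin N)) R₁ R₂ x) (fun U => U) (Δ2 x) U) (fun (a b : (geo9Y x).Site) => θ₂ * ((geo9Y x).M * α₀) * ((geo9Y x).len a ^ 2)⁻¹ * Real.exp (-(δ₂ * (geo9Y x).dist a b))))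
    (hta : ∀ x : MemberY θ.d₆ θ.ℓ₆ θ.hd' θ.hL' θ.b₀ θ.b₁ Mstar, M₀ ≤ (geo9Y x).M → ∀ α₀ : ℝ, 0 < α₀ → (geo9Y x).M * α₀ ≤ a₀ → ∀ U : (bg9YR (Matrix (Fin N) (Fin N) ℂ) (specialUnitaryUnits (Fin N)) R₁ R₂ x).Cfg, (bg9YR (Matrix (Fin N) (Fin N) ℂ) (specialUnitaryUnits (Fin N)) R₁ R₂ x).Reg335 c α₀ U →
      (bg9YR (Matrix (Fin N) (Fin N) ℂ) (specialUnitaryUnits (Fin N)) R₁ R₂ x).Reg336 c α₀ U → HasMaj (cNorm 1 (H x) (𝔬12 x).blk (fun y => (geo9Y_len_pos x y).le) 2) (cNorm 1 (H x) (𝔬12 x).blk (fun y => (geo9Y_len_pos x y).le) 0) (TaLcoK x.toKIdx (trBasis N) (bg9YR (Matrix (Fin N) (Fin N) ℂ) (specialUnitaryUnits (Fin N)) R₁ R₂ x) (fun U => U) (parT x.toKIdx) (GpPhysY x.toKIdx (parT x.toKIdx)) U) (fun a a' => tA * ((geo9Y x).M * α₀) * Real.exp (-(δT * (geo9Y x).dist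 a a'))))
    (hBJ : ∀ x : MemberY θ.d₆ θ.ℓ₆ θ.hd' θ.hL' θ.b₀ θ.b₁ Mstar, M₀ ≤ (geo9Y x).M → ∀ α₀ : ℝ, 0 < α₀ → (geo9Y x).M * α₀ ≤ a₀ → ∀ U : (bg9YR (Matrix (Fin N) (Fin N) ℂ) (specialUnitaryUnits (Fin N)) R₁ R₂ x).Cfg, (bg9YR (Matrix (Fin N) (Fin N) ℂ) (specialUnitaryUnits (Fin N)) R₁ R₂ x).Reg335 c α₀ U →
      (bg9YR (Matrix (Fin N) (Fin N) ℂ) (specialUnitaryUnits (Fin N)) R₁ R₂ x).Reg336 c α₀ U → CurrentMaj (𝔬12 x).blkW (𝔬12 x).blk (BcoKH x.toKIdx (trBasis N) (bg9YR (Matrix (Fin N) (Fin N) ℂ) (specialUnitaryUnits (Fin N)) R₁ R₂ x) (fun U => U) U)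
        (BdcoKH x.toKIdx (trBasis N) (bg9YR (Matrix (Fin N) (Fin N) ℂ) (specialUnitaryUnits (Fin N)) R₁ R₂ x) (fun U => U) U) 1 (H x) (tJ * ((geo9Y x).M * α₀)) δB)
    -- the G₀ layer (`g0_layer_of_thm310_coreDir₃USP`): Thm 3.3 for G₀ (blocks ∕ directions ∕ adjoint directions ∕ mixed L²), the (3.39)-hom letter ∇_UG₀, the identities; and Thm 3.3 for G₀ at
    -- the TRANSPORTED bond class (`thm33G0DirT_of_local3107`)
    (hG0 : ∀ x : MemberY θ.d₆ θ.ℓ₆ θ.hd' θ.hL' θ.b₀ θ.b₁ Mstar, M₀ ≤ (geo9Y x).M → ∀ α₀ : ℝ, 0 < α₀ → (geo9Y x).M * α₀ ≤ a₀ → ∀ U : (bg9YR (Matrix (Fin N) (Fin N) ℂ) (specialUnitaryUnits (Fin N)) R₁ R₂ x).Cfg, (bg9YR (Matrix (Fin N) (Fin N) ℂ) (specialUnitaryUnits (Fin N)) R₁ R₂ x).Reg335 c α₀ U →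
      (bg9YR (Matrix (Fin N) (Fin N) ℂ) (specialUnitaryUnits (Fin N)) R₁ R₂ x).Reg336 c α₀ U → Thm33G0 (𝔬12 x) 1 (H x) B12₀ δ12₀ U)
    (hG0D : ∀ x : MemberY θ.d₆ θ.ℓ₆ θ.hd' θ.hL' θ.b₀ θ.b₁ Mstar, M₀ ≤ (geo9Y x).M → ∀ α₀ : ℝ, 0 < α₀ → (geo9Y x).M * α₀ ≤ a₀ → ∀ U : (bg9YR (Matrix (Fin N) (Fin N) ℂ) (specialUnitaryUnits (Fin N)) R₁ R₂ x).Cfg, (bg9YR (Matrix (Fin N) (Fin N) ℂ) (specialUnitaryUnits (Fin N)) R₁ R₂ x).Reg335 c α₀ U →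
      (bg9YR (Matrix (Fin N) (Fin N) ℂ) (specialUnitaryUnits (Fin N)) R₁ R₂ x).Reg336 c α₀ U → Thm33G0Dir (𝔬12 x) (𝔭A x) (𝔡A x).Dd (𝔡A x).Dsd 1 (H x) (bHXA x) B12₀ Bh12 Bi12 Bi2₁₂ δ12₀ U)
    (hG0DR : ∀ x : MemberY θ.d₆ θ.ℓ₆ θ.hd' θ.hL' θ.b₀ θ.b₁ Mstar, M₀ ≤ (geo9Y x).M → ∀ α₀ : ℝ, 0 < α₀ → (geo9Y x).M * α₀ ≤ a₀ → ∀ U : (bg9YR (Matrix (Fin N) (Fin N) ℂ) (specialUnitaryUnits (Fin N)) R₁ R₂ x).Cfg, (bg9YR (Matrix (Fin N) (Fin N) ℂ) (specialUnitaryUnits (Fin N)) R₁ R₂ x).Reg335 c α₀ U →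
      (bg9YR (Matrix (Fin N) (Fin N) ℂ) (specialUnitaryUnits (Fin N)) R₁ R₂ x).Reg336 c α₀ U → Thm33G0DirR (𝔬12 x) (𝔡A x).Dsd 1 (H x) B12₀ δ12₀ U)
    (hG0L2M : ∀ x : MemberY θ.d₆ θ.ℓ₆ θ.hd' θ.hL' θ.b₀ θ.b₁ Mstar, M₀ ≤ (geo9Y x).M → ∀ α₀ : ℝ, 0 < α₀ → (geo9Y x).M * α₀ ≤ a₀ → ∀ U : (bg9YR (Matrix (Fin N) (Fin N) ℂ) (specialUnitaryUnits (Fin N)) R₁ R₂ x).Cfg, (bg9YR (Matrix (Fin N) (Fin N) ℂ) (specialUnitaryUnits (Fin N)) R₁ R₂ x).Reg335 c α₀ U →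
      (bg9YR (Matrix (Fin N) (Fin N) ℂ) (specialUnitaryUnits (Fin N)) R₁ R₂ x).Reg336 c α₀ U → Thm33G0L2M (𝔬12 x) (𝔡A x).Dd (𝔡A x).Dsd 1 (H x) B12₂ δ12₀ U)
    (he1 : ∀ x : MemberY θ.d₆ θ.ℓ₆ θ.hd' θ.hL' θ.b₀ θ.b₁ Mstar, M₀ ≤ (geo9Y x).M → ∀ α₀ : ℝ, 0 < α₀ → (geo9Y x).M * α₀ ≤ a₀ → ∀ U : (bg9YR (Matrix (Fin N) (Fin N) ℂ) (specialUnitaryUnits (Fin N)) R₁ R₂ x).Cfg, (bg9YR (Matrix (Fin N) (Fin N) ℂ) (specialUnitaryUnits (Fin N)) R₁ R₂ x).Reg335 c α₀ U → (bg9YR (Matrix (Fin N) (Fin N) ℂ) (specialUnitaryUnits (Fin N)) R₁ R₂ x).Reg336 c α₀ U →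
      HasMajorantHom (g := toB6 (geo9Y x) 1 (H x)) (𝔬12 x).blk (𝔬12 x).blkY ((𝔬12 x).D U ∘ₗ (𝔬12 x).G0 U) (fun (a b : (geo9Y x).Site) => B12₀ * (geo9Y x).len a * Real.exp (-(δ12₀ * (geo9Y x).dist a b))))
    (hI : ∀ x : MemberY θ.d₆ θ.ℓ₆ θ.hd' θ.hL' θ.b₀ θ.b₁ Mstar, M₀ ≤ (geo9Y x).M → ∀ α₀ : ℝ, 0 < α₀ → (geo9Y x).M * α₀ ≤ a₀ → ∀ U : (bg9YR (Matrix (Fin N) (Fin N) ℂ) (specialUnitaryUnits (Fin N)) R₁ R₂ x).Cfg, (bg9YR (Matrix (Fin N) (Fin N) ℂ) (specialUnitaryUnits (Fin N)) R₁ R₂ x).Reg335 c α₀ U →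
      (bg9YR (Matrix (Fin N) (Fin N) ℂ) (specialUnitaryUnits (Fin N)) R₁ R₂ x).Reg336 c α₀ U → B9Thm312Whole.Identities (𝔬12 x) U)
    (hG0CT : ∀ x : MemberY θ.d₆ θ.ℓ₆ θ.hd' θ.hL' θ.b₀ θ.b₁ Mstar, M₀ ≤ (geo9Y x).M → ∀ α₀ : ℝ, 0 < α₀ → (geo9Y x).M * α₀ ≤ a₀ → ∀ U : (bg9YR (Matrix (Fin N) (Fin N) ℂ) (specialUnitaryUnits (Fin N)) R₁ R₂ x).Cfg, (bg9YR (Matrix (Fin N) (Fin N) ℂ) (specialUnitaryUnits (Fin N)) R₁ R₂ x).Reg335 c α₀ U →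
      (bg9YR (Matrix (Fin N) (Fin N) ℂ) (specialUnitaryUnits (Fin N)) R₁ R₂ x).Reg336 c α₀ U → Thm33G0Dir (𝔬12 x) (𝔭A x) (𝔡A x).Dd (𝔡A x).Dsd 1 (H x) (bHXTA x U) B0T BhT BiT Bi2T δ12₀ U)
    -- print's (3.32) plaquette budget and rows 19's G₀-twin letters `h45X h44m h45Y` (dag-n06-c `h44m_h45X_h45Y_of_local3107`), inputs of the (3.46) legs `hXd ∕ dgDH ∕ pYDH`
    (hF : ∀ x : MemberY θ.d₆ θ.ℓ₆ θ.hd' θ.hL' θ.b₀ θ.b₁ Mstar, letI : Fintype (geo9K x.toKIdx).Site := (inferInstance : Fintype (geo9Y x).Site); M₀ ≤ (geo9Y x).M → ∀ α₀ : ℝ, 0 < α₀ → (geo9Y x).M * α₀ ≤ a₀ → ∀ U : (bg9YR (Matrix (Fin N) (Fin N) ℂ) (specialUnitaryUnits (Fin N)) R₁ R₂ x).Cfg, (bg9YR (Matrix (Fin N) (Fin N) ℂ) (specialUnitaryUnits (Fin N)) R₁ R₂ x).Reg335 c α₀ U →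
      (bg9YR (Matrix (Fin N) (Fin N) ℂ) (specialUnitaryUnits (Fin N)) R₁ R₂ x).Reg336 c α₀ U → ∀ (y : Site (PV θ.d₆ θ.ℓ₆ x.m x.K θ.hd' θ.hL') 0) (μ' ν' : Fin (θ.d₆ + 1)),
        ‖(plaqV U y μ' ν' : Matrix (Fin N) (Fin N) ℂ) - 1‖ ≤ ϑF * (((((θ.ℓ₆ + 1 : ℕ) : ℝ)) ^ levY x.toKIdx (chartY x.toKIdx y))⁻¹))
    (h45X : ∀ x : MemberY θ.d₆ θ.ℓ₆ θ.hd' θ.hL' θ.b₀ θ.b₁ Mstar, letI : Fintype (geo9K x.toKIdx).Site := (inferInstance : Fintype (geo9Y x).Site); M₀ ≤ (geo9Y x).M → ∀ α₀ : ℝ, 0 < α₀ → (geo9Y x).M * α₀ ≤ a₀ → ∀ U : (bg9YR (Matrix (Fin N) (Fin N) ℂ) (specialUnitaryUnits (Fin N)) R₁ R₂ x).Cfg, (bg9YR (Matrix (Fin N) (Fin N) ℂ) (specialUnitaryUnits (Fin N)) R₁ R₂ x).Reg335 c α₀ U →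
      (bg9YR (Matrix (Fin N) (Fin N) ℂ) (specialUnitaryUnits (Fin N)) R₁ R₂ x).Reg336 c α₀ U → ∀ (ν μ : Fin (θ.d₆ + 1)) (β' : ℝ) (h0 : 0 ≤ β') (h1 : β' < 1),
        HasMaj (bHZKP (κ := TrIdx N) x.toKIdx (trBasis N) (taxiB x.toKIdx (bg9YR (Matrix (Fin N) (Fin N) ℂ) (specialUnitaryUnits (Fin N)) R₁ R₂ x) (fun U => U) U) (R := (1 : ℝ)) (H := H x) (hsch0 β' h0 h1).le (hsch1 β' h0 h1).le) (cNormR 1 (H x) (𝔭A x).blkPX (fun y => (geo9Y_len_pos x y).le) (β' - 1))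
          ((𝔭A x).ΦX U β' ∘ₗ ((𝔡A x).Dd U ν ∘ₗ ((𝔬12 x).G0 U ∘ₗ (𝔡A x).Dsd U μ)))
          (fun a a' => BZ β' * Real.exp (-(δ45 * (geo9Y x).dist a a'))))
    (h44m : ∀ x : MemberY θ.d₆ θ.ℓ₆ θ.hd' θ.hL' θ.b₀ θ.b₁ Mstar, letI : Fintype (geo9K x.toKIdx).Site := (inferInstance : Fintype (geo9Y x).Site); M₀ ≤ (geo9Y x).M → ∀ α₀ : ℝ, 0 < α₀ → (geo9Y x).M * α₀ ≤ a₀ → ∀ U : (bg9YR (Matrix (Fin N) (Fin N) ℂ) (specialUnitaryUnits (Fin N)) R₁ R₂ x).Cfg, (bg9YR (Matrix (Fin N) (Fin N) ℂ) (specialUnitaryUnits (Fin N)) R₁ R₂ x).Reg335 c α₀ U →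
      (bg9YR (Matrix (Fin N) (Fin N) ℂ) (specialUnitaryUnits (Fin N)) R₁ R₂ x).Reg336 c α₀ U → ∀ ν μ : Fin (θ.d₆ + 1),
        HasMaj (bHZKP (κ := TrIdx N) x.toKIdx (trBasis N) (taxiB x.toKIdx (bg9YR (Matrix (Fin N) (Fin N) ℂ) (specialUnitaryUnits (Fin N)) R₁ R₂ x) (fun U => U) U) (R := (1 : ℝ)) (H := H x) hs440.le hs441.le) (cNorm 1 (H x) (𝔬12 x).blk (fun y => (geo9Y_len_pos x y).le) 1)
          ((𝔡A x).Dd U ν ∘ₗ ((𝔬12 x).G0 U ∘ₗ (𝔡A x).Dsd U μ)) (fun a a' => Bi44 * Real.exp (-(δ44 * (geo9Y x).dist a a'))))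
    (h45Y : ∀ x : MemberY θ.d₆ θ.ℓ₆ θ.hd' θ.hL' θ.b₀ θ.b₁ Mstar, letI : Fintype (geo9K x.toKIdx).Site := (inferInstance : Fintype (geo9Y x).Site); M₀ ≤ (geo9Y x).M → ∀ α₀ : ℝ, 0 < α₀ → (geo9Y x).M * α₀ ≤ a₀ → ∀ U : (bg9YR (Matrix (Fin N) (Fin N) ℂ) (specialUnitaryUnits (Fin N)) R₁ R₂ x).Cfg, (bg9YR (Matrix (Fin N) (Fin N) ℂ) (specialUnitaryUnits (Fin N)) R₁ R₂ x).Reg335 c α₀ U →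
      (bg9YR (Matrix (Fin N) (Fin N) ℂ) (specialUnitaryUnits (Fin N)) R₁ R₂ x).Reg336 c α₀ U → ∀ (β' : ℝ) (h0 : 0 ≤ β') (h1 : β' < 1) (μ : Fin (θ.d₆ + 1)),
        HasMaj (bHZKP (κ := TrIdx N) x.toKIdx (trBasis N) (taxiB x.toKIdx (bg9YR (Matrix (Fin N) (Fin N) ℂ) (specialUnitaryUnits (Fin N)) R₁ R₂ x) (fun U => U) U) (R := (1 : ℝ)) (H := H x) (hsch0 β' h0 h1).le (hsch1 β' h0 h1).le) (cNormR 1 (H x) (𝔭A x).blkPY (fun y => (geo9Y_len_pos x y).le) (β' - 1))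
          ((𝔭A x).ΦY U β' ∘ₗ ((𝔬12 x).D U ∘ₗ ((𝔬12 x).G0 U ∘ₗ (𝔡A x).Dsd U μ)))
          (fun a a' => BiY β' * Real.exp (-(δ45Y * (geo9Y x).dist a a'))))
    -- [CASCADE-K «K3-D»] THE CLASS LETTER OF `Q⋆(U)` DISPLAYED (dag-n06-l's law `hqsK` verbatim; today w5's `hasMaj_Qstar_of_pins` at the straight pair, knit: n06-l's `hqsK_knit_of_laws`), rate above the G₀∘Q⋆ transfer gap `δ12₀ + 1`
    (BQ δQ : ℝ) (hBQ : 0 ≤ BQ) (hδQ1 : δ12₀ + 1 ≤ δQ)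
    (hqsK : ∀ x : MemberY θ.d₆ θ.ℓ₆ θ.hd' θ.hL' θ.b₀ θ.b₁ Mstar, M₀ ≤ (geo9Y x).M → ∀ α₀ : ℝ, 0 < α₀ → (geo9Y x).M * α₀ ≤ a₀ →
      ∀ U : (bg9YR (Matrix (Fin N) (Fin N) ℂ) (specialUnitaryUnits (Fin N)) R₁ R₂ x).Cfg, (bg9YR (Matrix (Fin N) (Fin N) ℂ) (specialUnitaryUnits (Fin N)) R₁ R₂ x).Reg335 c α₀ U →
        HasMaj (weightNorm (BlockNorm.ofBlocks (toB6 (geo9Y x) 1 (H x)) (𝔬12 x).blkZ) (fun y => ((((θ.ℓ₆ + 1 : ℕ) : ℝ) ^ (θ.d₆ + 1)) ^ lvl x.hN x.D x.hk y)⁻¹) (fun y => (plateau_pos x.toKIdx y).le))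
          (cNorm 1 (H x) (𝔬12 x).blk (fun y => (geo9Y_len_pos x y).le) 0) ((𝔬12 x).Qstar U) (fun a a' => BQ * Real.exp (-(δQ * (geo9Y x).dist a a')))) :
    ∃ (MR aR : ℝ) (Br : ℝ → ℝ → ℝ), M₀ ≤ MR ∧ 0 < aR ∧ aR ≤ a₀ ∧ (∀ ε ε', 0 < ε' → ε' < 1 → ε' < ε → ε ≤ ε' + 1 → 0 ≤ Br ε ε') ∧
      ∀ x : MemberY θ.d₆ θ.ℓ₆ θ.hd' θ.hL' θ.b₀ θ.b₁ Mstar, MR ≤ (geo9Y x).M → ∀ α₀ : ℝ, 0 < α₀ → (geo9Y x).M * α₀ ≤ aR →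
        ∀ U : (bg9YR (Matrix (Fin N) (Fin N) ℂ) (specialUnitaryUnits (Fin N)) R₁ R₂ x).Cfg, (bg9YR (Matrix (Fin N) (Fin N) ℂ) (specialUnitaryUnits (Fin N)) R₁ R₂ x).Reg335 c α₀ U →
          (bg9YR (Matrix (Fin N) (Fin N) ℂ) (specialUnitaryUnits (Fin N)) R₁ R₂ x).Reg336 c α₀ U →
            ∀ (μ : Fin (θ.d₆ + 1)) (ε ε' : ℝ), 0 < ε' → ε' < 1 → ε' < ε → ε ≤ ε' + 1 →
              HasMaj (bHXA x ε) (bHXT x U ε') ((𝔬12 x).R U ∘ₗ (𝔬12 x).Dvstar U ∘ₗ (𝔬12 x).G1 U ∘ₗ (𝔡A x).Dsd U μ)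
                (fun (a a' : (geo9Y x).Site) => Br ε ε' * Real.exp (-(δ12₃ * (geo9Y x).dist a a'))) := by
  have hG' : ∀ x : MemberY θ.d₆ θ.ℓ₆ θ.hd' θ.hL' θ.b₀ θ.b₁ Mstar, GeoOK (geo9Y x) := fun x => ⟨geo9Y_dist_triangle x, geo9Y_dist_comm x, geo9K_dist_nonneg x.toKIdx, geo9Y_len_pos x⟩
  have hδ13 : 0 ≤ δ13 := by linarith only [hP3, h3P, hτR, hδ30, hσ, hτ]
  obtain ⟨MLR, c₁R, hrowR⟩ := rowSum261_geo9Y (d := θ.d₆) (ℓ := θ.ℓ₆) (hd := θ.hd') (hL := θ.hL') (b₀ := θ.b₀) (b₁ := θ.b₁) (Mstar := Mstar) 1 one_pos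
  -- §1 THE LEVEL-13 LETTERS AT THE INTERMEDIATE RATE δ13: dag-n06-c's gradient leg (UNIT D), the three (3.46) legs, the ∇-letters, the Φ^X∇-letter, dag-n06-l's G₀Q⋆ transfer letters
  obtain ⟨MDL, BdT, Bd2T, hMDL, hBdT, hBd2T, hLEG⟩ := dgDvd_pdgDvd_of_pinsT_all (N := N) H bI hβ1 𝔬12 𝔭A (fun x => (𝔡A x).Dd) (fun x => (𝔡A x).Dsd) h𝔡As hDvco12 bHXT hbHXT bHXTA hbHXTA hc10 hP
    ha₀ hδ13 h130.le hBiT hBi2T hG0CT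
  obtain ⟨MXd, BdX, hBdX, hXd⟩ := hXd_of_pinsP_geo9Y (N := N) (M₀ := M₀) (a₀ := a₀) H bI hβ1 hbI0 hGR c hϑF hF w13 hw13₀ hw13₁ sch hsch0 hsch1 hwsch bH13 hbH13 𝔬A 𝔬12 hDvco12 𝔡A h𝔡As 𝔭A
    hδ13 h1345 hBZ h45X
  obtain ⟨MDg, hDg⟩ := dgDH_dgDHd_of_pinsP_geo9Y (N := N) (M₀ := M₀) (a₀ := a₀) H bI hβ1 hbI0 hGR c hϑF hF w13 hw13₀ hw13₁ hs440 hs441 hw1344 bH13 hbH13 𝔬A 𝔬12 hDvco12 𝔡A h𝔡As h𝔡Ad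
    hblk12 hblkY12 hDco12 hδ13 h1344 hBi44 (B₃ := max 0 (max _ _))
    ((le_max_left _ _).trans (le_max_right _ _)) ((le_max_right _ _).trans (le_max_right _ _)) h44m -- B₃ := max 0 (max ⟨(3.46)-constant⟩ ⟨its Φ-twin⟩), read off the leg's two constant slots
  obtain ⟨MYd, BhD, hBhD, hYd⟩ := pYDH_of_pinsP_geo9Y (N := N) (M₀ := M₀) (a₀ := a₀) H bI hβ1 hbI0 hGR c hϑF hF w13 hw13₀ hw13₁ sch hsch0 hsch1 hwsch bH13 hbH13 𝔬A 𝔬12 hDvco12 𝔡A h𝔡As 𝔭A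
    hδ13 h1345Y hBiY h45Y
  obtain ⟨MDv, BZv, BXv, BLv, hMDv, hBZv, hBXv, hBLv, hDV⟩ := dv_letters_of_pins θ Mstar hGR bI hβ1 H 𝔬12 𝔭A parB h𝔭A O (fun x => (𝔡A x).Dd) (fun x => (𝔡A x).Dsd) h𝔡Ad h𝔡As
    hblk12 hblkW12 hblkY12 hG0co12 hDco12 hDsco12 hDvco12 (M12 := M₀) (a12 := a₀) hB12₀ hB12₂ hBh12 hδ13 h130 hG0DR hG0L2M (fun x hM α₀ hα ha U hU hU' => (hG0D x hM α₀ hα ha U hU hU').h43R)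
  obtain ⟨MDx, KX, hMDx, hKX, hPX⟩ := pXDv_of_pins_KX θ Mstar hGR bI hβ1 H 𝔬12 𝔭A parB h𝔭A O (fun x => (𝔡A x).Dsd) h𝔡As hblk12 hblkW12 hblkY12 hG0co12 hDsco12 hDvco12
    (M12 := M₀) (a12 := a₀) (Bh12 := Bh12) hBh12 hδ13 h130.le (fun x hM α₀ hα ha U hU hU' => (hG0D x hM α₀ hα ha U hU hU').h43R)
  obtain ⟨Mz, Bz, Bxz, hM0z, hBz, hBxz, hGT⟩ := N06G0QstarTransferLegAtPinsPULaws.g0qstar_transfer_letters_of_laws θ Mstar hGR bI hlev hβ1 H 𝔬12 𝔭A parB hparB h𝔭A (fun x => (𝔡A x).Dd) h𝔡Ad hblk12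
    (M12 := M₀) (a12 := a₀) hB12₀ hδ13 h130 BQ δQ hBQ hδQ1 hqsK (fun x hM α₀ hα ha U hU hU' => (hG0 x hM α₀ hα ha U hU hU').e0) (fun x hM α₀ hα ha U hU hU' => (hG0D x hM α₀ hα ha U hU hU').e1d)
  have hBxK : ∀ β : ℝ, 0 ≤ β → β < 1 → 0 ≤ KX * Bh12 β := fun β h0 h1 => mul_nonneg hKX (hBh12 β h0 h1)
  have hBxM : ∀ β : ℝ, 0 ≤ β → β < 1 → 0 ≤ max Bxz (KX * Bh12 β) := fun β _ _ => hBxz.trans (le_max_left _ _)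
  have hBx0M : 0 ≤ max Bxz (KX * BHG) := hBxz.trans (le_max_left _ _)
  have hwBxM : ∀ s : ℝ, 0 < s → s < 1 → wX s * max Bxz (KX * Bh12 s) ≤ max Bxz (KX * BHG) := fun s h0 h1 => by
    rw [mul_max_of_nonneg _ _ (hwX₀ s)]
    exact max_le_max (mul_le_of_le_one_left hBxz (hwX₁ s)) (by rw [mul_left_comm]; exact mul_le_mul_of_nonneg_left (hwBhG s h0 h1) hKX)
  obtain ⟨MW, hMDLW, hMXdW, hMDgW, hMYdW, hMDvW, hMDxW, hMzW, hMLRW⟩ : ∃ MW : ℝ, MDL ≤ MW ∧ MXd ≤ MW ∧ MDg ≤ MW ∧ MYd ≤ MW ∧ MDv ≤ MW ∧ MDx ≤ MW ∧ Mz ≤ MW ∧ MLR ≤ MW :=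
    ⟨max (max (max MDL MXd) (max MDg MYd)) (max (max MDv MDx) (max Mz MLR)),
      ((le_max_left _ _).trans (le_max_left _ _)).trans (le_max_left _ _), ((le_max_right _ _).trans (le_max_left _ _)).trans (le_max_left _ _),
      ((le_max_left _ _).trans (le_max_right _ _)).trans (le_max_left _ _), ((le_max_right _ _).trans (le_max_right _ _)).trans (le_max_left _ _),
      ((le_max_left _ _).trans (le_max_left _ _)).trans (le_max_right _ _), ((le_max_right _ _).trans (le_max_left _ _)).trans (le_max_right _ _),
      ((le_max_left _ _).trans (le_max_right _ _)).trans (le_max_right _ _), ((le_max_right _ _).trans (le_max_right _ _)).trans (le_max_right _ _)⟩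
  -- §2 THE SECOND STATE LAYER at (δK, δP) above the threshold `max M₀ MW`, level-13 slots at δ13
  obtain ⟨MTS, θS, θD12, A₀S, AWS, AQS, ADS, AQ1S, CRS, θH12, AIS, AVS, hθS, hθD12, hθH12, hA₀S, hAWS, hAQS, hADS, hAQ1S, hCRS, hAIS, hAVS, hST⟩ :=
    N06StateLayerAtPinsPUWPar.hStateTuplesW_of_pinsP_geo9Y_par (parT := parT) (N := N) (H := H) (bI := bI) (hlev := hlev) (hβ1 := hβ1) (hbI0 := hbI0) (hGR := hGR) (c := c) (M₀ := max M₀ MW) (a₀ := a₀) (hM₀ := hM₀.trans (le_max_left M₀ MW)) (hσ := hσ) (hτ := hτ)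
      (w13 := w13) (hw13₀ := hw13₀) (hw13₁ := hw13₁) (wX := wX) (hwX₀ := hwX₀) (hwX₁ := hwX₁) (hs440 := hs440) (hs441 := hs441) (hw1344 := hw1344) (hwX44 := hwX44) (bH13 := bH13) (hbH13 := hbH13) (hκ13 := hκ13) (bXH := bXH) (hbXH := hbXH) (bHXA := bHXA) (hbHXA := hbHXA) (bW := fun x U => bHXT x U) (CW := (Real.exp (1 * (rNear θ.d₆ θ.ℓ₆ + 1)) * max c₁R 0 * Real.exp ((δ13 - τ) * (rNear θ.d₆ θ.ℓ₆ + 1)))) (hCW := by positivity) (htransW := fun x hMz U ε hε K hK h => by letI : Fintype (B9GeoNormsKLevelV1.geo9K x.toKIdx).Site := (inferInstance : Fintype (geo9Y x).Site); rw [hbHXT x U]; exact (hasMaj_bHZPIfam_of_supBlocks x.toKIdx (trBasis N) (hβ1 x) (B9SmoothHolderClassTClosure.abs_cf_eq_nKT x.toKIdx x.hcfk) (taxiS x.toKIdx (bg9YR (Matrix (Fin N) (Fin N) ℂ) (specialUnitaryUnits (Fin N)) R₁ R₂ x) (fun U => U) U) ε (fun y => (hrowR x (hMLRW.trans ((le_max_right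 M₀ MW).trans hMz)) y).trans (le_max_left c₁R 0)) zero_le_one hK (by linarith only [hP3, h3P, hτR, hδ30, hσ, hτ]) h).mono fun a a' => le_of_eq rfl) (𝔬12 := 𝔬12) (hblk12 := hblk12) (hblkW12 := hblkW12) (Δ2 := Δ2) (hTpico12 := hTpico12) (hT2co12 := hT2co12) (hDvco12 := hDvco12) (hDvsco12 := hDvsco12) (𝔭A := 𝔭A) (hparB := hparB) (h𝔭A := h𝔭A) (Dd := fun x => (𝔡A x).Dd) (Dsd := fun x => (𝔡A x).Dsd) (hDd := h𝔡Ad) (Gp := fun x => GpY x.toKIdx (parT x.toKIdx)) (hGp := fun _ => rfl) (parS := fun x => parT x.toKIdx) (hparS := fun _ => rfl)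
      (hB₀ := hB₀) (hCP := hCP) (htJ := htJ) (hB43 := hB43) (htA := htA) (hθ₂ := hθ₂) (hB44 := hB44) (B12₃ := max Bz BZv) (Bx13 := fun β => max Bxz (KX * Bh12 β)) (hB12₃ := hBz.trans (le_max_left Bz BZv)) (hBx13 := hBxM) (hBx13₀ := hBx0M) (hwBx13 := hwBxM) (hB12₀ := hB12₀) (hBh12 := hBh12) (hBi := hBi12) (B₀G := B12₀) (δ₀G := δ12₀) (hB₀G := hB12₀) (hBhG := fun s hs0 hs1 => hBh12 s hs0.le hs1) (hBHG := hBHG) (hwBhG := hwBhG) (hBd := hBdT) (hB₃ := le_max_left _ _) (hBhD := hBhD) (hBdX := hBdX) (δK := δK) (δP := δP) (hδK := by linarith only [h3K, hτR, hδ30]) (hr0 := hr0) (hr49 := hr49) (hr2 := hr2) (hr44 := hr44) (hrB := hrB) (hr43 := hr43) (hrT := hrT) (hK3d := hK3d) (hKP := hKP) (hP0 := hP0) (hP3 := hP3) (hPG := by linarith only [hP0, hτ]) (h31 := fun x hMz => h31 x ((le_max_left M₀ MW).trans hMz))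
      (h49 := fun x hMz => h49 x ((le_max_left M₀ MW).trans hMz)) (h43 := fun x hMz => h43 x ((le_max_left M₀ MW).trans hMz)) (h44G := fun x hMz => h44G x ((le_max_left M₀ MW).trans hMz)) (hD2 := fun x hMz => hD2 x ((le_max_left M₀ MW).trans hMz)) (hta := fun x hMz => hta x ((le_max_left M₀ MW).trans hMz)) (hBJ := fun x hMz => hBJ x ((le_max_left M₀ MW).trans hMz)) (hZ81 := fun x hMz α₀ hα ha U hU hU' => ((hDV x (hMDvW.trans ((le_max_right M₀ MW).trans hMz)) α₀ hα ha U hU hU').1).mono (kernel_mono (hG' x) hBZv (le_max_right Bz BZv) le_rfl)) (hpXDv := (fun x hMz α₀ hα ha U hU hU' β h0 h1 => (hPX x (hMDxW.trans ((le_max_right M₀ MW).trans hMz)) α₀ hα ha U hU hU' β h0 h1).mono (kernel_mono (hG' x) (hBxK β h0 h1) (le_max_right Bxz (KX * Bh12 β)) le_rfl))) (he0 := fun x hMz α₀ hα ha U hU hU' => (hG0 x ((le_max_left M₀ MW).trans hMz) α₀ hα ha U hU hU').e0) (he1d := fun x hMz α₀ hα ha U hU hU' => (hG0D x ((le_max_left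 M₀ MW).trans hMz) α₀ hα ha U hU hU').e1d) (he2 := fun x hMz α₀ hα ha U hU hU' => (hG0 x ((le_max_left M₀ MW).trans hMz) α₀ hα ha U hU hU').e2) (h43RG := fun x hMz α₀ hα ha U hU hU' s' hs0 hs1 => (hG0D x ((le_max_left M₀ MW).trans hMz) α₀ hα ha U hU hU').h43R s' hs0.le hs1)
      (hgQs1 := fun x hMz α₀ hα ha U hU hU' => ((hGT x (hMzW.trans ((le_max_right M₀ MW).trans hMz)) α₀ hα ha U hU hU').1).mono (kernel_mono (hG' x) hBz (le_max_left Bz BZv) le_rfl)) (hpXQs := (fun x hMz α₀ hα ha U hU hU' β h0 h1 => ((hGT x (hMzW.trans ((le_max_right M₀ MW).trans hMz)) α₀ hα ha U hU hU').2 β h0 h1).mono (kernel_mono (hG' x) hBxz (le_max_left Bxz (KX * Bh12 β)) le_rfl))) (hDirR := fun x hMz α₀ hα ha U hU hU' => hG0DR x ((le_max_left M₀ MW).trans hMz) α₀ hα ha U hU hU') (hDir := fun x hMz α₀ hα ha U hU hU' => (hG0D x ((le_max_left M₀ MW).trans hMz) α₀ hα ha U hU hU').h44m) (hdgDvd :=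 fun x hMz α₀ hα ha U hU hU' ν ε hε => (hLEG x (hMDLW.trans ((le_max_right M₀ MW).trans hMz)) α₀ hα ha U hU hU').1 ν ε hε) (he1 := fun x hMz => he1 x ((le_max_left M₀ MW).trans hMz)) (h43L := fun x hMz α₀ hα ha U hU hU' => (hG0D x ((le_max_left M₀ MW).trans hMz) α₀ hα ha U hU hU').h43L) (h43d := fun x hMz α₀ hα ha U hU hU' => (hG0D x ((le_max_left M₀ MW).trans hMz) α₀ hα ha U hU hU').h43d)
      (hdgDH := fun x hMz α₀ hα ha U hU hU' => (hDg x (hMDgW.trans ((le_max_right M₀ MW).trans hMz)) α₀ hα ha U hU hU').2) (hdgDHd := fun x hMz α₀ hα ha U hU hU' => (hDg x (hMDgW.trans ((le_max_right M₀ MW).trans hMz)) α₀ hα ha U hU hU').1) (hYd := fun x hMz => hYd x (hMYdW.trans ((le_max_right M₀ MW).trans hMz))) (hXd := fun x hMz => hXd x (hMXdW.trans ((le_max_right M₀ MW).trans hMz)))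
  -- §3 dag-n06-c's LEG: the `hrgdd13` letter at (Br ε ε', δ12₃), source `bHXA x ε`, target `bHXT x U ε'`
  have hM0S : M₀ ≤ max (max M₀ MW) MTS := (le_max_left _ _).trans (le_max_left _ _)
  obtain ⟨MR, aR, Br, hMR, haR0, haR1, hBr, hRG⟩ := N06RgddLegAtPinsTPar.rgdd_of_pinsT_par (parT := parT) (N := N) H bI hβ1 hlev hbI0 𝔬12 𝔭A (fun x => (𝔡A x).Dd) (fun x => (𝔡A x).Dsd) h𝔡Ad hblk12
    (fun x => by rw [h𝔭A x]; rfl) (fun x U s => by rw [h𝔭A x, hparB x]; rfl) hDvsco12 hRco12 bHXA hbHXA bHXT hbHXT bXH hc10 hP (M₁ := max (max M₀ MW) MTS) (a₁ := a₀) ha₀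
    hθS hθD12 hθH12 hAIS hCRS hCP hBi12 hBi2₁₂ hτR hδ30 h3₀ h3P h3K h349
    (fun x hM α₀ hα ha U hU hU' => hG0D x (hM0S.trans hM) α₀ hα ha U hU hU') (fun x hM α₀ hα ha U hU hU' => hI x (hM0S.trans hM) α₀ hα ha U hU hU')
    (fun x hM α₀ hα ha U hU hU' => (hST x ((le_max_right _ _).trans hM) α₀ hα ha U hU hU').2.1)
    (fun x ε hε => by letI : Fintype (geo9K x.toKIdx).Site := (inferInstance : Fintype (geo9Y x).Site); simp only [hbHXA x]; exact exists_l1_control_bHK x.toKIdx (bI x) ε) (fun x hM α₀ hα ha U hU => h49 x (hM0S.trans hM) α₀ hα ha U hU)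
  exact ⟨MR, aR, Br, hM0S.trans hMR, haR0, haR1, hBr, hRG⟩

end Summit.QuantumFields.YangMills.BalabanUVNodes.N06Rgdd13AtPinsPUWPar
end
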